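import Mathlib
import Summits.Ventures.PercRepro.PuncturedLYMMixP1Q3Table1

/-!
# PercRepro — (SP) FOR `1` PAIRWISE DISJOINT PAIRS AND `3` PAIRWISE DISJOINT QUADRUPLES AT LEVEL `4`: POSITIVITY OF THE DENOMINATORS (1)
(p10, gen 41)

`den > 0`, `Pc > 0` for `n ≥ 14`; `Yc > 0` for `n ≥ 5`.  Nothing here asserts (SP).
-/

namespace PercRepro.PuncturedLYM.Split.TypeLift.MixP1Q3

/-- `den > 0` for `n ≥ 14`. -/
theorem den_pos (n : ℚ) (hn : 14 ≤ n) : 0 < den n := by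
  obtain ⟨n', hn', rfl⟩ : ∃ n', 0 ≤ n' ∧ n = 14 + n' := ⟨n - 14, by linarith, by ring⟩
  have h : den (14 + n') = 55296 * n' ^ 12 + 8354304 * n' ^ 11 + 577143168 * n' ^ 10 + 24107888736 * n' ^ 9 + 678158538576 * n' ^ 8 + 13534279720848 * n' ^ 7 + 196497625041792 * n' ^ 6 + 2091075213627072 * n' ^ 5 + 16187515216784400 * n' ^ 4 + 88896048942188880 * n' ^ 3 + 328716093604921248 * n' ^ 2 + 734821020538615296 * n' + 750928749146505216 := by unfold den; ring
  rw [h]; positivity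

/-- `Yc > 0` for `n ≥ 5`. -/
theorem Yc_pos (n : ℚ) (hn : 5 ≤ n) : 0 < Yc n := by
  obtain ⟨n', hn', rfl⟩ : ∃ n', 0 ≤ n' ∧ n = 5 + n' := ⟨n - 5, by linarith, by ring⟩
  have h : Yc (5 + n') = (1 / 120) * n' ^ 5 + (1 / 8) * n' ^ 4 + (17 / 24) * n' ^ 3 + (15 / 8) * n' ^ 2 + (137 / 60) * n' + 1 := by unfold Yc; ring
  rw [h]; positivity

/-- `Pc > 0` for `n ≥ 14`. -/
theorem Pc_pos (n : ℚ) (hn : 14 ≤ n) : 0 < Pc n := by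
  obtain ⟨n', hn', rfl⟩ : ∃ n', 0 ≤ n' ∧ n = 14 + n' := ⟨n - 14, by linarith, by ring⟩
  have h : Pc (14 + n') = (1 / 24) * n' ^ 4 + (25 / 12) * n' ^ 3 + (923 / 24) * n' ^ 2 + (3737 / 12) * n' + 932 := by unfold Pc; ring
  rw [h]; positivity

end PercRepro.PuncturedLYM.Split.TypeLift.MixP1Q3
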